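import Summits.QuantumFields.BalabanUV.T4Continuum.Support.NestedContourTransport

/-!
# T⁴ programme, spine node NE2 (U1a), tier B row B3.b-conc (ii) — NESTED-CONTOUR TRANSPORT, file 2: THE TWO-LEVEL CONSISTENCY OF THE
# CONTOUR TRANSPORTERS `transport_contour_two_level` (leaf-07's hypothesis shape `hT2`), explicit constant `thetaC`

NE2 formalisation swarm `b2b-balaban-t4-ne2-formalise-*`, seat leaf-06, row B3.b-conc (ii), file 2 of 2 (file 1 = `Support/NestedContour
Transport`: list algebra, legs, `leg_two_level`).  For leaf-07's contour `contour n M y j μ t` (the (1.7) legs from the block base point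
`n·y` through the corners, then the (1.18) line of `t` bonds in direction `μ`) and the REFINED contour `contour (L·n) M y (glue n L (j, r)) μ t′`
at the next spacing:

 * §1 corners: `cut`, `corner_eq_bpt_cut`, `cut_glue`, **`par_corner_glue_add_tstep`** (the `ν`-leg of the refined contour is a phase-aligned
   refinement of the `ν`-leg of the parent contour: all `L` fine bonds over one coarse bond share its parent — `LineAveragingPairing.par_bpt_
   glue_add_tstep` with the CUT offsets, whose `ν`-th fine coordinate is `0`), **`par_line_tail`** (after the `L − r_μ` head bonds the refined
   LINE is phase-aligned with the parent line shifted by one bond);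
 * §2 the constants `xiC`/`ThetaC`/`Bl`/**`thetaC L n d a′ a b = Bl^{d+1}·((d + 1)Θ + 2ξ + a)`** (`= O(d·e^{O(dα)}(α + β + α²)/n)` at
   `a′ = α/(Ln)`, `a = α/n`, `b = β/(Ln²)`) and the END theorem **`transport_contour_two_level`**:
   `‖transport (fine (L*n) M) R′ μ (contour (L*n) M y (glue n L (j, r)) μ t′) − transport (fine n M) R μ (contour n M y j μ ((r μ + t′)/L))‖
   ≤ thetaC L n d a′ a b` for EVERY `t′ < L·n` (including the overflow value `(r μ + t′)/L = n`), from fine size `a′`, coarse size `a` and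
   the per-bond connection consistency `b`; plus `consistency_div` (the `LipschitzBackgroundM.consistent` shape `‖c′•(R′ − 1) − c•(R∘par − 1)‖
   ≤ β₁`, `c′ = L·c`, gives `b = β₁/‖c′‖`).  Mechanism: legs by `leg_two_level` and `norm_prod_sub_prod_le` over the `d` legs; the line =
   head `H` (`‖H − 1‖ ≤ ξ`) times a phase-aligned tail (`leg_two_level` again); `‖P′W′ − PW‖ ≤ ‖P′ − P‖‖W′‖ + ‖P‖‖W′ − W‖`.

HONEST FRAMING (T4-DAG p. 1).  MODEL LEVEL: bond transporters at two adjacent spacings are DATA with size and per-bond consistency hypotheses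
(the consistency is NE3's currency, row B6 `Support/NE2FromNE3`, consumed as a hypothesis SHAPE — nothing of NE3 is proved or assumed here);
finite torus; exact list/lattice bookkeeping plus the triangle inequality; statements and constants OURS ([folklore]); the `[cite:]` tags locate
the printed OBJECTS ((1.6)–(1.7), (1.18) of [Balaban1984PropagatorsI], (3.19) of [Balaban1985BackgroundPropagators]).  ONE input (ii) of row
B3.b-conc of the NE2 skeleton; NOT [B9] (3.19)/(3.26) as printed, NOT NE2, no B0; NOT infinite volume, NOT a mass gap, NOT Clay, NOT summit
progress; spine 0/9 unchanged.  HONEST DEPENDENCY: continuum YM on T⁴ ⇐ BetaPertH ∧ nine spine estimates (0/9 proved); BetaPertH ⇐ (D1) ∧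
(D4) ∧ CAP+tail; G-an2-4 gates asym, D1 and NE2/3/4.  ABSOLUTE RULE kept; no `sorry`.
-/

noncomputable section

open scoped BigOperators ComplexConjugate Matrix Matrix.Norms.L2Operator
open Finset

namespace Summit.QuantumFields.BalabanUV.T4Continuum.NestedContourTransport

open Literature.MathematicalPhysics.QuantumFieldTheory.Balaban1983to89.B5Prop11Plancherel
open Literature.MathematicalPhysics.QuantumFieldTheory.Balaban1983to89.B5Block118
open Summit.QuantumFields.BalabanUV.T4Continuum.BalabanAveragedTowerModes (par)
open Summit.QuantumFields.BalabanUV.T4Continuum.CovariantBlockAveraging (transport transport_append leg length_leg corner contour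
  norm_transport_sub_one_le pow_sub_one_mono)
open Summit.QuantumFields.BalabanUV.T4Continuum.LineAveragingPairing (glue glue_val par_bpt_glue_add_tstep)

variable {d : ℕ}

/-! ## §1 Corners: the legs of the refined contour are phase-aligned refinements of the legs of the parent contour -/

section Corners

variable (n L : ℕ) [NeZero n] [NeZero L] (M : Fin d → ℕ) [hM : ∀ μ, NeZero (M μ)]

/-- the offset with the coordinates `≥ m` zeroed. [folklore] -/
def cut (N : ℕ) [NeZero N] (m : ℕ) (j : Fin d → Fin N) : Fin d → Fin N :=
  fun κ => if (κ : ℕ) < m then j κ else ⟨0, Nat.pos_of_ne_zero (NeZero.ne N)⟩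

omit hM in
/-- the corner after `m` directions is the block point of the cut offset. [folklore] -/
theorem corner_eq_bpt_cut (N : ℕ) [NeZero N] (y : Tor M) (j : Fin d → Fin N) (m : ℕ) :
    corner N M y j m = bpt N M y (cut N m j) := by
  rw [corner, bpt]
  congr 1
  funext κ
  simp only [iota, cut]
  split_ifs <;> simp

/-- glue commutes with cut. [folklore] -/
theorem cut_glue (m : ℕ) (j : Fin d → Fin n) (r : Fin d → Fin L) :
    cut (L * n) m (glue n L (j, r)) = glue n L (cut n m j, cut L m r) := by
  funext κ
  apply Fin.ext
  simp only [cut, glue_val]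
  split_ifs <;> simp [glue_val]

/-- **THE LEG CORNERS ARE PHASE-ALIGNED**: the parent of the refined contour's `ν`-leg point after `s` fine steps is the parent contour's
`ν`-leg point after `⌊s/L⌋` coarse steps. [folklore] -/
theorem par_corner_glue_add_tstep (y : Tor M) (j : Fin d → Fin n) (r : Fin d → Fin L) (ν : Fin d) (s : ℕ) :
    par n L M (corner (L * n) M y (glue n L (j, r)) ν + tstep (fine (L * n) M) ν s) = corner n M y j ν + tstep (fine n M) ν (s / L) := by
  rw [corner_eq_bpt_cut, cut_glue, par_bpt_glue_add_tstep, corner_eq_bpt_cut]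
  have h0 : ((cut L (ν : ℕ) r ν : Fin L) : ℕ) = 0 := by simp [cut]
  rw [h0, zero_add]

/-- **THE LINE TAIL IS PHASE-ALIGNED** after the `L − r_μ` head bonds: the parent of the point `L − r_μ + s` fine steps along the
line from `(Ln)y + Lj + r` is `ny + j + e_μ + ⌊s/L⌋e_μ`. [folklore] -/
theorem par_line_tail (y : Tor M) (j : Fin d → Fin n) (r : Fin d → Fin L) (μ : Fin d) (s : ℕ) :
    par n L M (bpt (L * n) M y (glue n L (j, r)) + tstep (fine (L * n) M) μ (L - (r μ : ℕ)) + tstep (fine (L * n) M) μ s)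
      = bpt n M y j + tstep (fine n M) μ 1 + tstep (fine n M) μ (s / L) := by
  have hL : 0 < L := Nat.pos_of_ne_zero (NeZero.ne L)
  have hr : (r μ : ℕ) < L := (r μ).isLt
  rw [add_assoc, ← tstep_add', par_bpt_glue_add_tstep, add_assoc, ← tstep_add']
  congr 2
  have e : (r μ : ℕ) + (L - (r μ : ℕ) + s) = s + L * 1 := by omega
  rw [e, Nat.add_mul_div_left s 1 hL, add_comm]

end Corners

/-! ## §2 THE CONTOUR: assembly of the legs and the line -/

section Contour

variable (n L : ℕ) [NeZero n] [NeZero L] (M : Fin d → ℕ) [hM : ∀ μ, NeZero (M μ)] {o : Type*} [Fintype o] [DecidableEq o]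

/-- the trailing-bond defect `ξ = (1 + a′)^L − 1`. [folklore] -/
def xiC (L : ℕ) (a' : ℝ) : ℝ := (1 + a') ^ L - 1

/-- the per-leg defect bound `Θ = Bc^{n+1}·(n·γ + ξ)`. [folklore] -/
def ThetaC (L n : ℕ) (a' a b : ℝ) : ℝ := Bc L a' a ^ (n + 1) * (n * gam L a' b + xiC L a')

/-- the uniform norm bound of leg transporters at both levels `Bl = (1 + a′)^{L·n}·(1 + a)^n`. [folklore] -/
def Bl (L n : ℕ) (a' a : ℝ) : ℝ := (1 + a') ^ (L * n) * (1 + a) ^ n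

/-- **THE EXPLICIT TWO-LEVEL CONSTANT** `θ = Bl^{d+1}·((d + 1)·Θ + 2ξ + a)` (for small `a′ = α/(Ln)`, `a = α/n`, `b = β/(Ln²)`:
`θ = O(d·e^{O(dα)}·(α + β + α²)/n)`). [folklore] -/
def thetaC (L n d : ℕ) (a' a b : ℝ) : ℝ := Bl L n a' a ^ (d + 1) * ((d + 1) * ThetaC L n a' a b + 2 * xiC L a' + a)

omit [NeZero n] [NeZero L] hM [Fintype o] [DecidableEq o] in
/-- `ξ ≥ 0`. [folklore] -/
theorem xiC_nonneg {a' : ℝ} (ha' : 0 ≤ a') : 0 ≤ xiC L a' := sub_nonneg.mpr (one_le_pow₀ (by linarith))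

omit [NeZero n] [NeZero L] hM [Fintype o] [DecidableEq o] in
/-- `Θ ≥ 0`. [folklore] -/
theorem ThetaC_nonneg {a' a b : ℝ} (ha' : 0 ≤ a') (ha : 0 ≤ a) (hb : 0 ≤ b) : 0 ≤ ThetaC L n a' a b := by
  unfold ThetaC
  have := one_le_Bc (L := L) ha' ha
  have := gam_nonneg (L := L) ha' hb
  have := xiC_nonneg (L := L) ha'
  positivity

omit [NeZero n] [NeZero L] hM [Fintype o] [DecidableEq o] in
/-- `Bl ≥ 1`. [folklore] -/
theorem one_le_Bl {a' a : ℝ} (ha' : 0 ≤ a') (ha : 0 ≤ a) : 1 ≤ Bl L n a' a :=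
  one_le_mul_of_one_le_of_one_le (one_le_pow₀ (by linarith)) (one_le_pow₀ (by linarith))

omit [NeZero n] [NeZero L] hM [Fintype o] [DecidableEq o] in
/-- `Θ` is monotone in the number of groups: `Bc^{m+1}(mγ + ξ) ≤ Θ` for `m ≤ n`. [folklore] -/
theorem legBound_le_ThetaC {a' a b : ℝ} (ha' : 0 ≤ a') (ha : 0 ≤ a) (hb : 0 ≤ b) {m : ℕ} (hm : m ≤ n) :
    Bc L a' a ^ (m + 1) * (m * gam L a' b + xiC L a') ≤ ThetaC L n a' a b := by
  unfold ThetaC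
  have hBc := one_le_Bc (L := L) ha' ha
  have hγ := gam_nonneg (L := L) ha' hb
  have hξ := xiC_nonneg (L := L) ha'
  have hmn : (m : ℝ) ≤ n := by exact_mod_cast hm
  exact mul_le_mul (pow_le_pow_right₀ hBc (by omega)) (by nlinarith) (by positivity) (by positivity)

omit [NeZero n] [NeZero L] hM in
/-- `zipWith` of two maps over the same list. [folklore] -/
theorem zipWith_map_map' {ι α β γ : Type*} (f : α → β → γ) (g : ι → α) (h : ι → β) (l : List ι) :
    List.zipWith f (l.map g) (l.map h) = l.map fun i => f (g i) (h i) := by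
  induction l with
  | nil => rfl
  | cons i l ih => rw [List.map_cons, List.map_cons, List.zipWith_cons_cons, ih, List.map_cons]

/-- **ROW B3.b-conc (ii) — THE TWO-LEVEL CONSISTENCY OF THE CONTOUR TRANSPORTERS** (leaf-07's hypothesis shape `hT2` of
`opNorm_Ecov_pairing_le`, journal l.6068): for bond transporters `R′` at spacing `(L·n)⁻¹` and `R` at spacing `n⁻¹` with fine size
`‖R′ − 1‖ ≤ a′`, coarse size `‖R − 1‖ ≤ a` and per-bond connection consistency `‖(R′_ν(x′) − 1) − L⁻¹(R_ν(par x′) − 1)‖ ≤ b` (the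
`LipschitzBackgroundM.consistent` shape divided by `L·n`; colour slot arbitrary), the transporter of the REFINED contour to the fine bond
`(Ln)y + (Lj + r) + t′e_μ` and the transporter of the PARENT contour to its parent bond `ny + j + ⌊(r_μ + t′)/L⌋e_μ` differ by at most
`thetaC L n d a′ a b`, for EVERY `t′ < L·n` (including the overflow value `⌊(r_μ + t′)/L⌋ = n`).  Mechanism: every complete group of
`L` consecutive fine bonds shares its parent coarse bond (`par_corner_glue_add_tstep`, `par_line_tail`); the `< L` trailing bonds of each
leg and the `L − r_μ` head bonds of the line are within `ξ` of `1`. [folklore] -/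
theorem transport_contour_two_level {R' : Fin d → (Tor (fine (L * n) M) × Fin d → Matrix o o ℂ)}
    {R : Fin d → (Tor (fine n M) × Fin d → Matrix o o ℂ)} {a' a b : ℝ} (ha' : 0 ≤ a') (ha : 0 ≤ a) (hb : 0 ≤ b)
    (hR' : ∀ ν i, ‖R' ν i - 1‖ ≤ a') (hR : ∀ ν i, ‖R ν i - 1‖ ≤ a)
    (hC : ∀ ν (x' : Tor (fine (L * n) M)) (κ : Fin d), ‖(R' ν (x', κ) - 1) - ((L : ℂ))⁻¹ • (R ν (par n L M x', κ) - 1)‖ ≤ b)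
    (y : Tor M) (μ : Fin d) (j : Fin d → Fin n) (r : Fin d → Fin L) (t' : ℕ) (ht' : t' < L * n) :
    ‖transport (fine (L * n) M) R' μ (contour (L * n) M y (glue n L (j, r)) μ t')
        - transport (fine n M) R μ (contour n M y j μ (((r μ : ℕ) + t') / L))‖ ≤ thetaC L n d a' a b := by
  have hL : 0 < L := Nat.pos_of_ne_zero (NeZero.ne L)
  have hn : 0 < n := Nat.pos_of_ne_zero (NeZero.ne n)
  have h1a' : (1 : ℝ) ≤ 1 + a' := by linarith
  have h1a : (1 : ℝ) ≤ 1 + a := by linarith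
  have hBl := one_le_Bl (L := L) (n := n) ha' ha
  have hBl0 : 0 ≤ Bl L n a' a := zero_le_one.trans hBl
  have hΘ := ThetaC_nonneg (L := L) (n := n) ha' ha hb
  have hξ := xiC_nonneg (L := L) ha'
  -- abbreviations
  set q : ℕ := ((r μ : ℕ) + t') / L with hq
  have hqn : q ≤ n := by
    rw [hq]; refine Nat.le_of_lt_succ ((Nat.div_lt_iff_lt_mul hL).mpr ?_)
    have := (r μ).isLt; nlinarith
  -- leg transporters and their norms
  set T' : Fin d → Matrix o o ℂ := fun ν =>
    transport (fine (L * n) M) R' μ (leg (L * n) M ν (corner (L * n) M y (glue n L (j, r)) ν) ((glue n L (j, r) ν : ℕ))) with hT'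
  set T : Fin d → Matrix o o ℂ := fun ν => transport (fine n M) R μ (leg n M ν (corner n M y j ν) (j ν : ℕ)) with hT
  have hT'n : ∀ ν, ‖T' ν‖ ≤ Bl L n a' a := fun ν => by
    refine ((norm_transport_leg_le (L * n) M ha' hR' μ ν _ _).trans (pow_le_pow_right₀ h1a' ?_)).trans
      (le_mul_of_one_le_right (pow_nonneg (by linarith) _) (one_le_pow₀ h1a))
    rw [glue_val]; have := (j ν).isLt; have := (r ν).isLt; nlinarith
  have hTn : ∀ ν, ‖T ν‖ ≤ Bl L n a' a := fun ν =>
    ((norm_transport_leg_le n M ha hR μ ν _ _).trans (pow_le_pow_right₀ h1a (j ν).isLt.le)).trans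
      (le_mul_of_one_le_left (pow_nonneg (by linarith) _) (one_le_pow₀ h1a'))
  have hTT : ∀ ν, ‖T' ν - T ν‖ ≤ ThetaC L n a' a b := fun ν => by
    have h := leg_two_level n L M ha' ha hR' hR hC ν μ (corner (L * n) M y (glue n L (j, r)) ν) (corner n M y j ν)
      (par_corner_glue_add_tstep n L M y j r ν) (j ν) (r ν) (r ν).isLt.le
    rw [show L * (j ν : ℕ) + (r ν : ℕ) = (glue n L (j, r) ν : ℕ) from (glue_val n L (j, r) ν).symm] at h
    exact h.trans (legBound_le_ThetaC n L ha' ha hb (j ν).isLt.le)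
  -- the legs together
  have eL' : transport (fine (L * n) M) R' μ ((List.finRange d).flatMap fun ν =>
        leg (L * n) M ν (corner (L * n) M y (glue n L (j, r)) ν) ((glue n L (j, r) ν : ℕ))) = ((List.finRange d).map T').prod :=
    transport_flatMap (L * n) M R' μ _ _
  have eL : transport (fine n M) R μ ((List.finRange d).flatMap fun ν => leg n M ν (corner n M y j ν) (j ν : ℕ))
      = ((List.finRange d).map T).prod := transport_flatMap n M R μ _ _
  have hLegs : ‖((List.finRange d).map T').prod - ((List.finRange d).map T).prod‖ ≤ Bl L n a' a ^ d * (d * ThetaC L n a' a b) := by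
    have h := norm_prod_sub_prod_le ((List.finRange d).map T') ((List.finRange d).map T) (by simp) hBl
      (fun X hX => by obtain ⟨ν, _, rfl⟩ := List.mem_map.mp hX; exact hT'n ν)
      (fun X hX => by obtain ⟨ν, _, rfl⟩ := List.mem_map.mp hX; exact hTn ν)
    rw [List.length_map, List.length_finRange, zipWith_map_map'] at h
    refine h.trans (mul_le_mul_of_nonneg_left ?_ (pow_nonneg hBl0 _))
    have h3 := List.sum_le_card_nsmul ((List.finRange d).map fun ν => ‖T' ν - T ν‖) (ThetaC L n a' a b) (fun x hx => by
      obtain ⟨ν, _, rfl⟩ := List.mem_map.mp hx; exact hTT ν)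
    rw [List.length_map, List.length_finRange, nsmul_eq_mul] at h3; exact h3
  have hLegs'n : ‖((List.finRange d).map T').prod‖ ≤ Bl L n a' a ^ d := by
    have h := norm_prod_le_pow ((List.finRange d).map T') hBl (fun X hX => by obtain ⟨ν, _, rfl⟩ := List.mem_map.mp hX; exact hT'n ν)
    rwa [List.length_map, List.length_finRange] at h
  have hLegsn : ‖((List.finRange d).map T).prod‖ ≤ Bl L n a' a ^ d := by
    have h := norm_prod_le_pow ((List.finRange d).map T) hBl (fun X hX => by obtain ⟨ν, _, rfl⟩ := List.mem_map.mp hX; exact hTn ν)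
    rwa [List.length_map, List.length_finRange] at h
  -- the line
  set z' := bpt (L * n) M y (glue n L (j, r)) with hz'
  set z := bpt n M y j with hz
  have hLine'n : ‖transport (fine (L * n) M) R' μ (leg (L * n) M μ z' t')‖ ≤ Bl L n a' a :=
    ((norm_transport_leg_le (L * n) M ha' hR' μ μ _ _).trans (pow_le_pow_right₀ h1a' ht'.le)).trans
      (le_mul_of_one_le_right (pow_nonneg (by linarith) _) (one_le_pow₀ h1a))
  have hLine : ‖transport (fine (L * n) M) R' μ (leg (L * n) M μ z' t') - transport (fine n M) R μ (leg n M μ z q)‖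
      ≤ Bl L n a' a * (ThetaC L n a' a b + xiC L a' + a) + xiC L a' := by
    by_cases hlt : (r μ : ℕ) + t' < L
    · -- no complete group: the coarse line is empty
      have hq0 : q = 0 := by rw [hq]; exact Nat.div_eq_of_lt hlt
      have eC0 : transport (fine n M) R μ (leg n M μ z q) = 1 := by rw [hq0]; simp [leg, transport]
      rw [eC0]
      have h := norm_transport_sub_one_le (fine (L * n) M) ha' hR' μ (Γ := leg (L * n) M μ z' t') (ℓ := L)
        (by rw [length_leg]; omega)
      have h0 : 0 ≤ Bl L n a' a * (ThetaC L n a' a b + xiC L a' + a) := by positivity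
      calc _ ≤ (1 + a') ^ L - 1 := h
        _ = xiC L a' := rfl
        _ ≤ _ := by linarith
    · -- head of `L − r_μ` bonds, then the phase-aligned tail
      replace hlt : L ≤ (r μ : ℕ) + t' := not_lt.mp hlt
      have hq1 : 1 ≤ q := by rw [hq]; exact (Nat.le_div_iff_mul_le hL).mpr (by simpa using hlt)
      set e : ℕ := ((r μ : ℕ) + t') % L with he
      have heL : e ≤ L := (Nat.mod_lt _ hL).le
      have ht'split : t' = (L - (r μ : ℕ)) + (L * (q - 1) + e) := by
        have h1 := Nat.div_add_mod ((r μ : ℕ) + t') L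
        rw [← hq, ← he] at h1
        have hr := (r μ).isLt
        have h2 : L * q = L * (q - 1) + L := by
          have h3 : q = (q - 1) + 1 := by omega
          conv_lhs => rw [h3]
          ring
        omega
      set z'' := z' + tstep (fine (L * n) M) μ (L - (r μ : ℕ)) with hz''
      set H := transport (fine (L * n) M) R' μ (leg (L * n) M μ z' (L - (r μ : ℕ))) with hH
      set Tl' := transport (fine (L * n) M) R' μ (leg (L * n) M μ z'' (L * (q - 1) + e)) with hTl'
      set C0 := R μ (z + tstep (fine n M) μ 0, μ) with hC0
      set Tl := transport (fine n M) R μ (leg n M μ (z + tstep (fine n M) μ 1) (q - 1)) with hTl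
      have eF : transport (fine (L * n) M) R' μ (leg (L * n) M μ z' t') = H * Tl' := by
        rw [ht'split, leg_add, transport_append]
      have eC : transport (fine n M) R μ (leg n M μ z q) = C0 * Tl := by
        rw [show q = 1 + (q - 1) by omega, leg_add, transport_append, transport_leg, hTl, hC0]
        congr 1
        simp [tstep_zero]
      rw [eF, eC]
      have hHn : ‖H - 1‖ ≤ xiC L a' := by
        have h := norm_transport_sub_one_le (fine (L * n) M) ha' hR' μ (Γ := leg (L * n) M μ z' (L - (r μ : ℕ))) (ℓ := L)
          (by rw [length_leg]; omega)
        exact h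
      have hC0n : ‖C0‖ ≤ 1 + a := norm_le_one_add (hR μ _)
      have hHC : ‖H - C0‖ ≤ xiC L a' + a := by
        calc ‖H - C0‖ = ‖(H - 1) - (C0 - 1)‖ := by congr 1; abel
          _ ≤ ‖H - 1‖ + ‖C0 - 1‖ := norm_sub_le _ _
          _ ≤ xiC L a' + a := add_le_add hHn (hR μ _)
      have hTl'n : ‖Tl'‖ ≤ Bl L n a' a := by
        refine ((norm_transport_leg_le (L * n) M ha' hR' μ μ _ _).trans (pow_le_pow_right₀ h1a' ?_)).trans
          (le_mul_of_one_le_right (pow_nonneg (by linarith) _) (one_le_pow₀ h1a))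
        have := (r μ).isLt; omega
      have hTail : ‖Tl' - Tl‖ ≤ ThetaC L n a' a b := by
        have h := leg_two_level n L M ha' ha hR' hR hC μ μ z'' (z + tstep (fine n M) μ 1)
          (fun s => by rw [hz'', hz', hz]; exact par_line_tail n L M y j r μ s) (q - 1) e heL
        exact h.trans (legBound_le_ThetaC n L ha' ha hb (by omega))
      have e2 : H * Tl' - C0 * Tl = (H - C0) * Tl' + C0 * (Tl' - Tl) := by noncomm_ring
      rw [e2]
      calc ‖(H - C0) * Tl' + C0 * (Tl' - Tl)‖ ≤ ‖H - C0‖ * ‖Tl'‖ + ‖C0‖ * ‖Tl' - Tl‖ :=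
            (norm_add_le _ _).trans (add_le_add (Matrix.l2_opNorm_mul _ _) (Matrix.l2_opNorm_mul _ _))
        _ ≤ (xiC L a' + a) * Bl L n a' a + (1 + a) * ThetaC L n a' a b :=
            add_le_add (mul_le_mul hHC hTl'n (norm_nonneg _) (by positivity)) (mul_le_mul hC0n hTail (norm_nonneg _) (by positivity))
        _ ≤ Bl L n a' a * (ThetaC L n a' a b + xiC L a' + a) + xiC L a' := by
            have h1aB : 1 + a ≤ Bl L n a' a := by
              calc (1 : ℝ) + a = 1 * (1 + a) ^ 1 := by ring
                _ ≤ (1 + a') ^ (L * n) * (1 + a) ^ n :=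
                    mul_le_mul (one_le_pow₀ h1a') (pow_le_pow_right₀ h1a hn) (by positivity) (by positivity)
            nlinarith
  -- assembly
  rw [contour, contour, transport_append, transport_append, eL', eL]
  simp only [glue_val] at eL' ⊢
  set P' := ((List.finRange d).map T').prod
  set P := ((List.finRange d).map T).prod
  set W' := transport (fine (L * n) M) R' μ (leg (L * n) M μ z' t')
  set W := transport (fine n M) R μ (leg n M μ z q)
  have e3 : P' * W' - P * W = (P' - P) * W' + P * (W' - W) := by noncomm_ring
  rw [e3]
  calc ‖(P' - P) * W' + P * (W' - W)‖ ≤ ‖P' - P‖ * ‖W'‖ + ‖P‖ * ‖W' - W‖ :=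
        (norm_add_le _ _).trans (add_le_add (Matrix.l2_opNorm_mul _ _) (Matrix.l2_opNorm_mul _ _))
    _ ≤ Bl L n a' a ^ d * (d * ThetaC L n a' a b) * Bl L n a' a
          + Bl L n a' a ^ d * (Bl L n a' a * (ThetaC L n a' a b + xiC L a' + a) + xiC L a') :=
        add_le_add (mul_le_mul hLegs hLine'n (norm_nonneg _) (by positivity)) (mul_le_mul hLegsn hLine (norm_nonneg _) (by positivity))
    _ ≤ thetaC L n d a' a b := by
        unfold thetaC
        have hB1 : Bl L n a' a ^ d * xiC L a' ≤ Bl L n a' a ^ (d + 1) * xiC L a' :=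
          mul_le_mul_of_nonneg_right (pow_le_pow_right₀ hBl (Nat.le_succ d)) hξ
        have e4 : Bl L n a' a ^ d * (d * ThetaC L n a' a b) * Bl L n a' a
              + Bl L n a' a ^ d * (Bl L n a' a * (ThetaC L n a' a b + xiC L a' + a) + xiC L a')
            = Bl L n a' a ^ (d + 1) * ((d + 1) * ThetaC L n a' a b + xiC L a' + a) + Bl L n a' a ^ d * xiC L a' := by ring
        have e5 : Bl L n a' a ^ (d + 1) * ((d + 1) * ThetaC L n a' a b + 2 * xiC L a' + a)
            = Bl L n a' a ^ (d + 1) * ((d + 1) * ThetaC L n a' a b + xiC L a' + a) + Bl L n a' a ^ (d + 1) * xiC L a' := by ring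
        rw [e4, e5]
        linarith

end Contour

/-! ### From the `LipschitzBackgroundM.consistent` shape to the per-bond hypothesis `hC` -/

section Conversion

variable {o : Type*} [Fintype o] [DecidableEq o]

/-- dividing the connection consistency `‖c′•(X′ − 1) − c•(X − 1)‖ ≤ β₁` (`c′ = L·c ≠ 0`) by `c′`:
`‖(X′ − 1) − L⁻¹(X − 1)‖ ≤ β₁/‖c′‖`. [folklore] -/
theorem consistency_div (L : ℕ) {c c' : ℂ} (hc' : c' = (L : ℂ) * c) (hc'0 : c' ≠ 0) (X' X : Matrix o o ℂ) {β₁ : ℝ}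
    (h : ‖c' • (X' - 1) - c • (X - 1)‖ ≤ β₁) : ‖(X' - 1) - ((L : ℂ))⁻¹ • (X - 1)‖ ≤ β₁ / ‖c'‖ := by
  have hL : (L : ℂ) ≠ 0 := by rintro hL0; rw [hL0, zero_mul] at hc'; exact hc'0 hc'
  have hc : c = ((L : ℂ))⁻¹ * c' := by rw [hc', ← mul_assoc, inv_mul_cancel₀ hL, one_mul]
  have e : (X' - 1) - ((L : ℂ))⁻¹ • (X - 1) = c'⁻¹ • (c' • (X' - 1) - c • (X - 1)) := by
    rw [hc, smul_sub (c'⁻¹), smul_smul, smul_smul, inv_mul_cancel₀ hc'0, one_smul,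
      show c'⁻¹ * (((L : ℂ))⁻¹ * c') = ((L : ℂ))⁻¹ by rw [mul_left_comm, inv_mul_cancel₀ hc'0, mul_one]]
  rw [e, norm_smul, norm_inv, div_eq_inv_mul]
  exact mul_le_mul_of_nonneg_left h (inv_nonneg.mpr (norm_nonneg _))

end Conversion

end Summit.QuantumFields.BalabanUV.T4Continuum.NestedContourTransport

end
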